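import Summits.ValiantsHypothesis.ValiantsHypothesis.Theorems.TwoAdicLadderPrecisionLadderLadderZCalibration
import Summits.ValiantsHypothesis.ValiantsHypothesis.Theorems.TwoAdicLadderLadderOfVHTransfer
import Literature.NumberTheory.LocalFields.PadicSolutionsFromCongruences
import Literature.Computability.AlgebraicComplexity.StandardFamiliesProofs

/-!
# TwoAdicLadder — crux `PrecisionLadder` (stmt-ValiantsHypothesis-5948), line `birth`,
# registered stub `stub_ladderZ`: THE STUB IS EXACTLY "per ∉ VP OVER THE 2-ADIC INTEGERS ℤ₂"

The registered open stub of `Cruxes/PrecisionLadder/Lines/birth.lean`,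

  `stub_ladderZ : ∀ c, ∃ᶠ n in atTop, ∃ k, n ^ c < complexity (perPoly (Fin n) (ZMod (2 ^ (k + 1))))`,

quantifies over infinitely many finite rings. This file relocates it, kernel-checked, as ONE
hardness statement over ONE characteristic-zero discrete valuation ring:

  `ladderZ_iff_not_isPComputable_padicInt :  stub_ladderZ  ↔  ¬ IsPComputable (per over ℤ_[2])`

("the permanent has no polynomial-size circuits with `2`-adic integer constants"). Consequently
(file `…LadderZOfVH.lean`, which adds the route-dependent `VH ⇒ stub`)
`VH ↔ stub_ladderZ ∧ (VP_ℂ = VNP_ℂ → per ∈ VP_{ℤ₂})`: the gap between the stub and the summit is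
precisely `2`-ADIC INTEGRAL NORMALISATION OF CONSTANTS (replace `ℂ`-constants, equivalently
`ℚ̄₂`-constants, by `ℤ₂`-constants at polynomial cost) — the union of what the route files as
`TwoIntegralNormalisation` (division by `2`) and `stub_descent` (ramified / inert constants).
This file imports no route file.

## Proof

* `→` is free: `ℤ₂ → ℤ/2^k` is a ring map (`PadicInt.toZModPow`), extension of scalars is free.
* `←` is a COMPACTNESS TRANSFER (`complexity_map_padicInt_le_of_zmod_pow`, any prime `p`, any integer
  polynomial `f₀`): if `L_{ℤ/p^k}(f₀) ≤ s` for every `k` then `L_{ℤ_p}(f₀) ≤ 21877 (N + deg f₀ + s + 2)²⁶`.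
  As in the tree's `complexity_map_complex_le_of_twoAdic` (the engine of `LadderOfVH`), Raz's integer
  universal circuit `U` (`RazUniversal.exists_universalCircuit_int`) turns "`L_R(f₀) ≤ s`" into the
  solvability over `R` of ONE finite system of integer polynomial equations in the labels
  (`aeval_universal_eq_iff`); a system solvable modulo every `p^k` is solvable in `ℤ_p`
  (`exists_padicInt_solution_of_zmod_pow` — Serre, *Cours d'arithmétique* II §2.1 Prop. 5, in the
  tree as `Literature.NumberTheory.LocalFields.exists_common_zero_iff_forall_zmod`); and a `ℤ_p`-point
  of the label system is a projection `f₀ = U(x, α)` over `ℤ_p` (`complexity_le_of_isProjection`,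
  `complexity_map_le`).  No ultrafilter, no transfer to `ℂ`: the witness ring is `ℤ_p` itself.
* The polynomial loss is absorbed by the exponent form (`pow_envelope`:
  `21877 (n² + n + n^c + 2)²⁶ ≤ n^(26c+119)` for `n ≥ 2`).

Honest framing (rung currency): a relocation/calibration of an OPEN stub, not a rung: `stub_ladderZ`,
the crux `PrecisionLadder` and `VP ≠ VNP` are NOT proved, and nothing here is progress on them. No
new definitions, no named facts, no sorry.

## References

* J.-P. Serre, *A Course in Arithmetic*, GTM 7 (1973), Ch. II §2.1 Prop. 5 (solutions in `ℤ_p` from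
  solutions modulo `pⁿ`). [cite: Serre1973, Ch. II §2.1 Prop. 5]
* P. Bürgisser, *Completeness and Reduction in Algebraic Complexity Theory* (2000), §4.1 (extension
  of scalars; dependence of `VP = VNP` on the ground ring). [cite: Burgisser2000, §4.1]
* R. Raz, *Elusive functions and lower bounds for arithmetic circuits*, Theory Comput. 6 (2010),
  Prop. 3.3 (universal circuit). [cite: Raz2010, Prop. 3.3]
-/

noncomputable section

open MvPolynomial

-- the summit and the problem share the name `ValiantsHypothesis` (D-0017 single-conjunct layout)
set_option linter.dupNamespace false

namespace Summit.ValiantsHypothesis.ValiantsHypothesis.Theorems.TwoAdicLadderPrecisionLadder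

open Filter Literature.Computability.AlgebraicComplexity

/-! ### §1. Integer systems: solvable modulo every `p^k` ⇒ solvable in `ℤ_p` -/

/-- **Compactness of `ℤ_p` for integer polynomial systems** (Serre II §2.1 Prop. 5, integer
coefficients): a finite system of integer polynomial equations that is solvable in `ℤ/p^k` for every
`k` is solvable in `ℤ_p`. (Tree: `exists_common_zero_iff_forall_zmod` for `ℤ_p`-coefficients, applied
to the image system; the reductions of `ℤ → ℤ_p → ℤ/p^k` compose to `ℤ → ℤ/p^k`.) [cite: Serre1973, Ch. II §2.1 Prop. 5] -/
theorem exists_padicInt_solution_of_zmod_pow (p : ℕ) [Fact p.Prime] {m s : ℕ}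
    (S : Fin s → MvPolynomial (Fin m) ℤ)
    (hsol : ∀ k, ∃ z : Fin m → ZMod (p ^ k), ∀ i, eval₂ (Int.castRingHom (ZMod (p ^ k))) z (S i) = 0) :
    ∃ z : Fin m → ℤ_[p], ∀ i, eval₂ (Int.castRingHom ℤ_[p]) z (S i) = 0 := by
  have key := (Literature.NumberTheory.LocalFields.exists_common_zero_iff_forall_zmod
    (fun i => MvPolynomial.map (Int.castRingHom ℤ_[p]) (S i))).2
  have hcomp : ∀ k, (PadicInt.toZModPow k).comp (Int.castRingHom ℤ_[p]) =
      Int.castRingHom (ZMod (p ^ k)) := fun k => RingHom.ext_int _ _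
  obtain ⟨x, hx⟩ := key (fun k => by
    obtain ⟨z, hz⟩ := hsol k
    refine ⟨z, fun i => ?_⟩
    rw [MvPolynomial.map_map, hcomp, MvPolynomial.eval_map]
    exact hz i)
  refine ⟨x, fun i => ?_⟩
  have h := hx i
  rwa [MvPolynomial.eval_map] at h

/-! ### §2. Small circuits modulo every `p^k` give a small circuit over `ℤ_p` -/

/-- **Compactness transfer for complexity.** If an integer polynomial `f₀ ∈ ℤ[x₁,…,x_N]` has
circuits of size `≤ s` over `ℤ/p^k` for EVERY `k`, then
`L_{ℤ_p}(f₀) ≤ 21877 · (N + deg f₀ + s + 2)²⁶`: Raz's integer universal circuit turns the hypothesis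
into the solvability modulo every `p^k` of one finite integer system in the labels
(`aeval_universal_eq_iff`), which is then solvable in `ℤ_p` (`exists_padicInt_solution_of_zmod_pow`),
and a `ℤ_p`-solution exhibits `f₀` as a projection of the universal polynomial over `ℤ_p`. (The
`ℤ_p`-valued twin of the tree's `complexity_map_complex_le_of_twoAdic`.) [cite: Burgisser2000, §4.1] -/
theorem complexity_map_padicInt_le_of_zmod_pow (p : ℕ) [Fact p.Prime] {N : ℕ}
    (f₀ : MvPolynomial (Fin N) ℤ) (s : ℕ)
    (hc : ∀ k, complexity (MvPolynomial.map (Int.castRingHom (ZMod (p ^ k))) f₀) ≤ s) :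
    complexity (MvPolynomial.map (Int.castRingHom ℤ_[p]) f₀) ≤
      21877 * (N + f₀.totalDegree + s + 2) ^ 26 := by
  -- adapted from `TwoAdicLadder.complexity_map_complex_le_of_twoAdic` (LadderOfVHTransfer), `ℤ_p` for `ℂ`
  classical
  obtain ⟨q, U, -, hU, -, -, huniv⟩ :=
    RazUniversal.exists_universalCircuit_int.{0} N s f₀.totalDegree
  -- the integer system
  set V := sumAlgEquiv ℤ (Fin N) (Fin q) U with hV
  let M : Finset (Fin N →₀ ℕ) := V.support ∪ f₀.support
  let E : (Fin N →₀ ℕ) → MvPolynomial (Fin q) ℤ := fun m => coeff m V - C (coeff m f₀)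
  let Sys : Fin M.card → MvPolynomial (Fin q) ℤ := fun i => E (M.equivFin.symm i)
  -- solvable in every `ℤ/p^k`
  have hsol : ∀ k, ∃ z : Fin q → ZMod (p ^ k), ∀ i,
      eval₂ (Int.castRingHom (ZMod (p ^ k))) z (Sys i) = 0 := by
    intro k
    obtain ⟨α, hα⟩ := huniv (ZMod (p ^ k)) (MvPolynomial.map (Int.castRingHom (ZMod (p ^ k))) f₀)
      (TwoAdicLadder.totalDegree_map_le_int f₀) (hc k)
    refine ⟨α, fun i => ?_⟩
    have h := (TwoAdicLadder.aeval_universal_eq_iff U f₀ α).mp hα (M.equivFin.symm i)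
    rw [TwoAdicLadder.aeval_eq_eval₂_int] at h
    exact h
  -- hence solvable in `ℤ_p`
  obtain ⟨ζ, hζ⟩ := exists_padicInt_solution_of_zmod_pow p Sys hsol
  have hall : ∀ m : Fin N →₀ ℕ, aeval ζ (E m) = 0 := by
    intro m
    by_cases hm : m ∈ M
    · have := hζ (M.equivFin ⟨m, hm⟩)
      rw [TwoAdicLadder.aeval_eq_eval₂_int]
      simpa [Sys] using this
    · change aeval ζ (coeff m V - C (coeff m f₀)) = 0
      rw [TwoAdicLadder.universal_eq_trivial U f₀ hm, map_zero]
  have hspec : aeval (Sum.elim X fun j => C (ζ j)) (MvPolynomial.map (Int.castRingHom ℤ_[p]) U) =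
      MvPolynomial.map (Int.castRingHom ℤ_[p]) f₀ :=
    (TwoAdicLadder.aeval_universal_eq_iff U f₀ ζ).mpr hall
  -- projections and extension of scalars are free
  have hproj : IsProjection (MvPolynomial.map (Int.castRingHom ℤ_[p]) f₀)
      (MvPolynomial.map (Int.castRingHom ℤ_[p]) U) := by
    refine ⟨Sum.elim X fun j => C (ζ j), fun i => ?_, hspec.symm⟩
    rcases i with i | j
    · exact Or.inl ⟨i, rfl⟩
    · exact Or.inr ⟨ζ j, rfl⟩
  calc complexity (MvPolynomial.map (Int.castRingHom ℤ_[p]) f₀)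
      ≤ complexity (MvPolynomial.map (Int.castRingHom ℤ_[p]) U) := complexity_le_of_isProjection hproj
    _ ≤ complexity U := ArithCircuit.complexity_map_le _ _
    _ ≤ 21877 * (N + f₀.totalDegree + s + 2) ^ 26 := hU

/-- **The permanent, `p = 2`.** If `L_{ℤ/2^(k+1)}(per_n) ≤ s` for every precision `k`, then
`L_{ℤ₂}(per_n) ≤ 21877 · (n² + n + s + 2)²⁶` (`complexity_map_padicInt_le_of_zmod_pow` for the
integer permanent in `Fin (n·n)` variables, `deg per_n = n`; precision `0`, the zero ring `ℤ/1`, is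
covered by monotonicity). [cite: Burgisser2000, §4.1] -/
theorem complexity_perPoly_padicInt_le_of_zmod_pow (n s : ℕ)
    (hc : ∀ k, complexity (perPoly (Fin n) (ZMod (2 ^ (k + 1)))) ≤ s) :
    complexity (perPoly (Fin n) ℤ_[2]) ≤ 21877 * (n * n + n + s + 2) ^ 26 := by
  -- adapted from `TwoAdicLadder.complexity_perPoly_complex_le_of_twoAdic` (LadderOfVH)
  classical
  have hc' : ∀ k, complexity (perPoly (Fin n) (ZMod (2 ^ k))) ≤ s := fun k =>
    (complexity_perPoly_zmod_two_pow_mono n (Nat.le_succ k)).trans (hc k)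
  let e : Fin n × Fin n ≃ Fin (n * n) := finProdFinEquiv
  let f₀ : MvPolynomial (Fin (n * n)) ℤ := rename e (perPoly (Fin n) ℤ)
  have hmap : ∀ (B : Type) [CommRing B],
      MvPolynomial.map (Int.castRingHom B) f₀ = rename e (perPoly (Fin n) B) := by
    intro B _
    simp only [f₀, map_rename, map_perPoly]
  have hdeg : f₀.totalDegree ≤ n := by
    refine (totalDegree_rename_le _ _).trans ?_
    rw [totalDegree_perPoly_holds, Fintype.card_fin]
  have hcR : ∀ k, complexity (MvPolynomial.map (Int.castRingHom (ZMod (2 ^ k))) f₀) ≤ s := by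
    intro k
    rw [hmap, complexity_rename_of_injective_holds e.injective]
    exact hc' k
  have h := complexity_map_padicInt_le_of_zmod_pow 2 f₀ s hcR
  rw [hmap, complexity_rename_of_injective_holds e.injective] at h
  clear_value f₀
  refine h.trans (Nat.mul_le_mul_left _ (Nat.pow_le_pow_left ?_ 26))
  omega

/-- The free direction: `L_{ℤ/2^k}(per_n) ≤ L_{ℤ₂}(per_n)` (reduce a `2`-adic circuit modulo `2^k`
along `PadicInt.toZModPow k`). [cite: Burgisser2000, §4.1] -/
theorem complexity_perPoly_zmod_le_padicInt (n k : ℕ) :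
    complexity (perPoly (Fin n) (ZMod (2 ^ k))) ≤ complexity (perPoly (Fin n) ℤ_[2]) := by
  have hle := ArithCircuit.complexity_map_le (PadicInt.toZModPow (p := 2) k) (perPoly (Fin n) ℤ_[2])
  rwa [map_perPoly] at hle

/-! ### §3. The stub, relocated over `ℤ₂` -/

/-- Exponent bookkeeping: `21877 · (n² + n + n^c + 2)²⁶ ≤ n^(26c + 119)` for `n ≥ 2`
(`n² + n + n^c + 2 ≤ 4 n^(c+2) ≤ n^(c+4)`, `21877 < 2¹⁵ ≤ n¹⁵`). [folklore] -/
theorem pow_envelope (c : ℕ) {n : ℕ} (hn : 2 ≤ n) :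
    21877 * (n * n + n + n ^ c + 2) ^ 26 ≤ n ^ (26 * c + 119) := by
  have h1 : n * n ≤ n ^ (c + 2) := by
    calc n * n = n ^ 2 := (sq n).symm
      _ ≤ n ^ (c + 2) := Nat.pow_le_pow_right (by omega) (by omega)
  have h2 : n ≤ n ^ (c + 2) := by
    calc n = n ^ 1 := (pow_one n).symm
      _ ≤ n ^ (c + 2) := Nat.pow_le_pow_right (by omega) (by omega)
  have h3 : n ^ c ≤ n ^ (c + 2) := Nat.pow_le_pow_right (by omega) (by omega)
  have h4 : 2 ≤ n ^ (c + 2) := hn.trans h2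
  have h5 : 4 ≤ n ^ 2 := by nlinarith
  have hsum : n * n + n + n ^ c + 2 ≤ n ^ (c + 4) := by
    calc n * n + n + n ^ c + 2 ≤ 4 * n ^ (c + 2) := by omega
      _ ≤ n ^ 2 * n ^ (c + 2) := Nat.mul_le_mul_right _ h5
      _ = n ^ (c + 4) := by ring
  have h6 : 21877 ≤ n ^ 15 := by
    calc (21877 : ℕ) ≤ 2 ^ 15 := by norm_num
      _ ≤ n ^ 15 := Nat.pow_le_pow_left hn 15
  calc 21877 * (n * n + n + n ^ c + 2) ^ 26 ≤ n ^ 15 * (n ^ (c + 4)) ^ 26 :=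
        Nat.mul_le_mul h6 (Nat.pow_le_pow_left hsum 26)
    _ = n ^ (26 * c + 119) := by ring

/-- **`stub_ladderZ` ⟺ the permanent is not p-computable over the `2`-adic integers.** The
registered stub (left, verbatim) says exactly that `per` has no polynomial-size arithmetic circuits
with constants in `ℤ₂`. `→`: reduce modulo `2^(k+1)`; `←`: the compactness transfer
`complexity_perPoly_padicInt_le_of_zmod_pow` plus `pow_envelope`. (So, in strength:
`per ∉ VP_ℂ = VH ⟹ per ∉ VP_{ℤ₂} = stub ⟹ per ∉ VP_ℤ ⟹ τ(per) not p-bounded`.) [cite: Serre1973, Ch. II §2.1 Prop. 5] -/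
theorem ladderZ_iff_not_isPComputable_padicInt :
    (∀ c : ℕ, ∃ᶠ n in atTop, ∃ k : ℕ,
        n ^ c < complexity (perPoly (Fin n) (ZMod (2 ^ (k + 1))))) ↔
      ¬ IsPComputable (fun n => perPoly (Fin n) ℤ_[2]) := by
  rw [not_isPComputable_iff_frequently_lt]
  constructor
  · intro hZ c
    refine (hZ c).mono ?_
    rintro n ⟨k, hk⟩
    exact hk.trans_le (complexity_perPoly_zmod_le_padicInt n (k + 1))
  · intro h c
    refine ((h (26 * c + 119)).and_eventually (eventually_ge_atTop 2)).mono ?_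
    rintro n ⟨hlt, hn⟩
    by_contra hk
    push Not at hk
    have hle := (complexity_perPoly_padicInt_le_of_zmod_pow n (n ^ c) hk).trans (pow_envelope c hn)
    exact absurd (hlt.trans_le hle) (lt_irrefl _)

end Summit.ValiantsHypothesis.ValiantsHypothesis.Theorems.TwoAdicLadderPrecisionLadder

end
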